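import Literature.NumberTheory.EllipticCurves.FormalGroupMultiplicationUniversalProofs
import Literature.NumberTheory.EllipticCurves.TorsionCardinality
import Mathlib.Algebra.MvPolynomial.Funext
import HarnessLib

/-!
# Division polynomials and the formal multiplication: `ΨSqₙ(x(z))·x([n](z)) = Φₙ(x(z))` in `R⟦z⟧`,
# and the degree `ℓ² - ℓ` of `ΨSq_ℓ` for an ordinary curve in characteristic `ℓ`

`Proofs` file (theorems only, no definitions, no named facts) in topic
`NumberTheory/EllipticCurves`.

For a Weierstrass equation `W` over a commutative ring `R` let `u = z²x(z) ∈ R⟦z⟧`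
(`WeierstrassCurve.formalXMulSq`, Silverman *AEC* IV.1: `x(z) = z/w(z) = z⁻² - a₁z⁻¹ - ⋯`),
`[n](z) ∈ R⟦z⟧` the formal multiplication by `n` (`WeierstrassCurve.formalMul`, AEC IV.2), and
`ΨSqₙ = ψₙ²`, `Φₙ ∈ R[x]` Mathlib's univariate division polynomials (`x([n]P) = Φₙ(x)/ΨSqₙ(x)`,
AEC Exercise 3.7).  Clearing the poles of `x(z) = u/z²` in `ΨSqₙ(x(z)) · x([n](z)) = Φₙ(x(z))`
gives the identity of power series

  `(Σᵢ ΨSqₙ[i] uⁱ z^{2(n²-1-i)}) · z² · u([n](z)) = (Σᵢ Φₙ[i] uⁱ z^{2(n²-i)}) · [n](z)²`   (∗)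

(both sums finite: `deg ΨSqₙ ≤ n² - 1`, `deg Φₙ ≤ n²`).

* `WeierstrassCurve.sum_ΨSq_mul_formalXMulSq_subst_formalMul` — **(∗) holds for every
  Weierstrass equation over every commutative ring.**  Proof: for a `p`-integral equation over
  `ℚ_p` both sides are integral series taking the same value at every `t = z(P)`, `P ∈ E₁(ℚ_p)`
  (`‖t‖ < 1`), by the tree's dictionary `z²x(z)|_{z(P)} = x(P)z(P)²`
  (`padicEval_formalXMulSq_eq`), `[n](z(P)) = z(nP)` (`padicEval_formalMul_formalParameter`) and
  the multiplication formula `x(nP)·ΨSqₙ(x(P)) = Φₙ(x(P))` (`mul_eval_ΨSq_of_zsmul_eq`; when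
  `nP = O` both sides vanish, `zsmul_some_eq_zero_iff_eval_ΨSq`), hence they are equal
  (`eq_of_padicEval_eq`); the universal equation over `ℤ[a₁, a₂, a₃, a₄, a₆]`
  (`WeierstrassCurve.universalInt`) specialises to `p`-integral equations at every point of
  `ℤ_p⁵`, so the coefficients of the two sides — polynomials in the `aᵢ` — agree
  (`MvPolynomial.funext` over the infinite domain `ℤ_p`), and every `W` is a specialisation of the
  universal one (`universalInt_map`).
* `WeierstrassCurve.natDegree_ΨSq_eq_of_hasseCoeff_ne_zero`,
  `WeierstrassCurve.leadingCoeff_ΨSq_eq_of_hasseCoeff_ne_zero` — over an integral domain of odd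
  prime characteristic `ℓ`, if the Hasse invariant `A_ℓ(W)` (`WeierstrassCurve.hasseCoeff`) is
  nonzero (**ordinary** curve) then **`deg ΨSq_ℓ = ℓ² - ℓ` with leading coefficient `A_ℓ²`**
  (so `ψ_ℓ ≡ ±A_ℓ x^{(ℓ²-ℓ)/2} + ⋯`).  Proof: modulo `ℓ`, `[ℓ](z) = A_ℓ z^ℓ + O(z^{ℓ+1})`
  (the tree's `coeff_prime_formalMul_sub_hasseCoeff_mem_span`, `coeff_formalMul_prime_mem_span`:
  Katz–Mazur 12.4.2, AEC IV.4.4 with V.4.1(a)), so the right side of (∗) is `z^{2ℓ}(A_ℓ² + O(z))`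
  while the left side is `z^{2(ℓ²-D)}(c + O(z))`, `D = deg ΨSq_ℓ`, `c` its leading coefficient.

These are the division-polynomial form of "the kernel of reduction meets `E[ℓ]` in a group of
order `ℓ` at a prime of good ordinary reduction" (Serre, *Abelian ℓ-adic representations* (1968),
IV, A.2.2; Silverman AEC V.3.1(a), VII.2–3), used in that form in the sequel.

## References

* [SilvermanAEC2009] J. H. Silverman, *The Arithmetic of Elliptic Curves*, 2nd ed. (2009):
  IV.1 (`x(z)`), IV.2.3 (`[m]`), IV.4.4, V.3.1(a), V.4.1(a), VII.2.2, Exercise 3.7(d),(f).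
* [KatzMazur1985] N. M. Katz, B. Mazur, *Arithmetic Moduli of Elliptic Curves* (1985), 12.4.2.
* [SerreAbelianLadic1968] J.-P. Serre, *Abelian ℓ-adic representations and elliptic curves*
  (1968), Ch. IV, A.2.2.

## Design

No definitions; the two sides of (∗) are written out as `Finset` sums.  `noncomputable section`,
`open scoped Classical` (points of Weierstrass curves, as in `TorsionCardinality`).
-/

noncomputable section

open scoped Classical
open PowerSeries Polynomial Literature.NumberTheory.EllipticCurves

namespace WeierstrassCurve

/-! ### The two sides of (∗) and their base change -/

section General

variable {R : Type*} [CommRing R] (W : WeierstrassCurve R)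

/-- Base change of the left sum of (∗). [folklore] -/
theorem map_sum_ΨSq_formalXMulSq {S : Type*} [CommRing S] (φ : R →+* S) (n : ℕ) :
    PowerSeries.map φ (∑ i ∈ Finset.range (n ^ 2),
        PowerSeries.C ((W.ΨSq n).coeff i) * W.formalXMulSq ^ i * PowerSeries.X ^ (2 * (n ^ 2 - 1 - i))) =
      ∑ i ∈ Finset.range (n ^ 2),
        PowerSeries.C (((W.map φ).ΨSq n).coeff i) * (W.map φ).formalXMulSq ^ i *
          PowerSeries.X ^ (2 * (n ^ 2 - 1 - i)) := by
  rw [map_sum]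
  refine Finset.sum_congr rfl fun i _ => ?_
  rw [map_mul, map_mul, map_pow, map_pow, PowerSeries.map_C, PowerSeries.map_X, map_formalXMulSq,
    map_ΨSq, Polynomial.coeff_map]

/-- Base change of the right sum of (∗). [folklore] -/
theorem map_sum_Φ_formalXMulSq {S : Type*} [CommRing S] (φ : R →+* S) (n : ℕ) :
    PowerSeries.map φ (∑ i ∈ Finset.range (n ^ 2 + 1),
        PowerSeries.C ((W.Φ n).coeff i) * W.formalXMulSq ^ i * PowerSeries.X ^ (2 * (n ^ 2 - i))) =
      ∑ i ∈ Finset.range (n ^ 2 + 1),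
        PowerSeries.C (((W.map φ).Φ n).coeff i) * (W.map φ).formalXMulSq ^ i *
          PowerSeries.X ^ (2 * (n ^ 2 - i)) := by
  rw [map_sum]
  refine Finset.sum_congr rfl fun i _ => ?_
  rw [map_mul, map_mul, map_pow, map_pow, PowerSeries.map_C, PowerSeries.map_X, map_formalXMulSq,
    map_Φ, Polynomial.coeff_map]

/-- Base change of `u([n](z))`. [folklore] -/
theorem map_formalXMulSq_subst_formalMul {S : Type*} [CommRing S] (φ : R →+* S) (n : ℕ) :
    PowerSeries.map φ (W.formalXMulSq.subst (W.formalMul n)) =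
      (W.map φ).formalXMulSq.subst ((W.map φ).formalMul n) := by
  rw [powerSeries_map_subst φ (PowerSeries.HasSubst.of_constantCoeff_zero' (W.constantCoeff_formalMul n)),
    map_formalXMulSq, map_formalMul]

end General

/-! ### `p`-adic evaluation of finite sums -/

section PadicSums

variable {p : ℕ} [Fact p.Prime]

/-- A finite sum of integral series is integral. [folklore] -/
theorem _root_.Literature.NumberTheory.EllipticCurves.isPadicInt_finset_sum {ι : Type*}
    (s : Finset ι) (f : ι → ℚ_[p]⟦X⟧) (h : ∀ i ∈ s, IsPadicInt (f i)) :
    IsPadicInt (∑ i ∈ s, f i) := by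
  induction s using Finset.induction_on with
  | empty => rw [Finset.sum_empty]; exact IsPadicInt.zero
  | insert a s ha ih =>
    rw [Finset.sum_insert ha]
    exact (h a (Finset.mem_insert_self a s)).add
      (ih fun i hi => h i (Finset.mem_insert_of_mem hi))

/-- Evaluation of a finite sum of integral series is the sum of the evaluations. [folklore] -/
theorem _root_.Literature.NumberTheory.EllipticCurves.padicEval_finset_sum {ι : Type*}
    (s : Finset ι) (f : ι → ℚ_[p]⟦X⟧) (h : ∀ i ∈ s, IsPadicInt (f i)) {t : ℚ_[p]} (ht : ‖t‖ < 1) :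
    padicEval (∑ i ∈ s, f i) t = ∑ i ∈ s, padicEval (f i) t := by
  induction s using Finset.induction_on with
  | empty => rw [Finset.sum_empty, Finset.sum_empty, padicEval_zero_left]
  | insert a s ha ih =>
    rw [Finset.sum_insert ha, Finset.sum_insert ha,
      padicEval_add (h a (Finset.mem_insert_self a s))
        (isPadicInt_finset_sum s f fun i hi => h i (Finset.mem_insert_of_mem hi)) ht,
      ih fun i hi => h i (Finset.mem_insert_of_mem hi)]

/-- `(C c · f^i · X^k)(t) = c · f(t)^i · t^k`. [folklore] -/
theorem _root_.Literature.NumberTheory.EllipticCurves.padicEval_C_mul_pow_mul_X_pow {c : ℚ_[p]}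
    (hc : ‖c‖ ≤ 1) {f : ℚ_[p]⟦X⟧} (hf : IsPadicInt f) (i k : ℕ) {t : ℚ_[p]} (ht : ‖t‖ < 1) :
    padicEval (PowerSeries.C c * f ^ i * PowerSeries.X ^ k) t = c * padicEval f t ^ i * t ^ k := by
  rw [padicEval_mul ((IsPadicInt.powerSeries_C hc).mul (hf.pow i)) (IsPadicInt.powerSeries_X.pow k) ht,
    padicEval_mul (IsPadicInt.powerSeries_C hc) (hf.pow i) ht, padicEval_pow hf ht,
    padicEval_pow IsPadicInt.powerSeries_X ht, padicEval_C, padicEval_X]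

end PadicSums

/-! ### (∗) for a `p`-integral equation over `ℚ_p`, at the points of `E₁(ℚ_p)` -/

section Padic

variable {p : ℕ} [Fact p.Prime] (W : WeierstrassCurve ℚ_[p]) [hW : W.IsIntegral ℤ_[p]]

/-- The coefficients of `ΨSqₙ` of a `p`-integral equation are `p`-adic integers. [folklore] -/
theorem norm_coeff_ΨSq_le_one (n i : ℕ) : ‖(W.ΨSq n).coeff i‖ ≤ 1 := by
  have h : W.ΨSq n = ((W.integralModel ℤ_[p]).ΨSq n).map PadicInt.Coe.ringHom := by
    conv_lhs => rw [← W.eq_map_integralModel]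
    rw [map_ΨSq]
  rw [h, Polynomial.coeff_map]
  exact PadicInt.norm_le_one _

/-- The coefficients of `Φₙ` of a `p`-integral equation are `p`-adic integers. [folklore] -/
theorem norm_coeff_Φ_le_one (n i : ℕ) : ‖(W.Φ n).coeff i‖ ≤ 1 := by
  have h : W.Φ n = ((W.integralModel ℤ_[p]).Φ n).map PadicInt.Coe.ringHom := by
    conv_lhs => rw [← W.eq_map_integralModel]
    rw [map_Φ]
  rw [h, Polynomial.coeff_map]
  exact PadicInt.norm_le_one _

/-- The left sum of (∗) is integral. [folklore] -/
theorem isPadicInt_sum_ΨSq (n : ℕ) :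
    IsPadicInt (∑ i ∈ Finset.range (n ^ 2),
      PowerSeries.C ((W.ΨSq n).coeff i) * W.formalXMulSq ^ i * PowerSeries.X ^ (2 * (n ^ 2 - 1 - i))) :=
  isPadicInt_finset_sum _ _ fun i _ =>
    ((IsPadicInt.powerSeries_C (W.norm_coeff_ΨSq_le_one n i)).mul (W.isPadicInt_formalXMulSq.pow i)).mul
      (IsPadicInt.powerSeries_X.pow _)

/-- The right sum of (∗) is integral. [folklore] -/
theorem isPadicInt_sum_Φ (n : ℕ) :
    IsPadicInt (∑ i ∈ Finset.range (n ^ 2 + 1),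
      PowerSeries.C ((W.Φ n).coeff i) * W.formalXMulSq ^ i * PowerSeries.X ^ (2 * (n ^ 2 - i))) :=
  isPadicInt_finset_sum _ _ fun i _ =>
    ((IsPadicInt.powerSeries_C (W.norm_coeff_Φ_le_one n i)).mul (W.isPadicInt_formalXMulSq.pow i)).mul
      (IsPadicInt.powerSeries_X.pow _)

/-- `u([n](z))` is integral. [folklore] -/
theorem isPadicInt_formalXMulSq_subst_formalMul (n : ℕ) :
    IsPadicInt (W.formalXMulSq.subst (W.formalMul n)) :=
  W.isPadicInt_formalXMulSq.powerSeries_subst (W.isPadicInt_formalMul n)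
    (PowerSeries.HasSubst.of_constantCoeff_zero' (W.constantCoeff_formalMul n))

/-- **The left sum of (∗) at `z(P)`**: `Σᵢ ΨSqₙ[i] (x z²)ⁱ z^{2(n²-1-i)} = z^{2(n²-1)} ΨSqₙ(x)` for
`P = (x, y) ∈ E₁(ℚ_p)`, `z = -x/y` (using `z²x(z)|_{z(P)} = x z(P)²`).
[Silverman AEC IV.1, VII.2.2] [cite: SilvermanAEC2009, VII.2.2] -/
theorem padicEval_sum_ΨSq {x y : ℚ_[p]} (heq : W.toAffine.Equation x y) (hx : 1 < ‖x‖) (n : ℕ)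
    (hn : 0 < n) :
    padicEval (∑ i ∈ Finset.range (n ^ 2),
      PowerSeries.C ((W.ΨSq n).coeff i) * W.formalXMulSq ^ i * PowerSeries.X ^ (2 * (n ^ 2 - 1 - i)))
        (-x / y) = (-x / y) ^ (2 * (n ^ 2 - 1)) * (W.ΨSq n).eval x := by
  obtain ⟨-, -, hz1, -, -⟩ := W.param_facts heq hx
  rw [padicEval_finset_sum _ _ (fun i _ =>
    ((IsPadicInt.powerSeries_C (W.norm_coeff_ΨSq_le_one n i)).mul (W.isPadicInt_formalXMulSq.pow i)).mul
      (IsPadicInt.powerSeries_X.pow _)) hz1]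
  have hdeg : (W.ΨSq n).natDegree < n ^ 2 := by
    refine (W.natDegree_ΨSq_le n).trans_lt ?_
    rw [Int.natAbs_natCast]
    exact Nat.sub_lt (pow_pos hn 2) one_pos
  rw [Polynomial.eval_eq_sum_range' hdeg, Finset.mul_sum]
  refine Finset.sum_congr rfl fun i hi => ?_
  rw [Finset.mem_range] at hi
  rw [padicEval_C_mul_pow_mul_X_pow (W.norm_coeff_ΨSq_le_one n i) W.isPadicInt_formalXMulSq i _ hz1,
    W.padicEval_formalXMulSq_eq heq hx, mul_pow, ← pow_mul, mul_assoc, mul_assoc, ← pow_add]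
  have e : 2 * i + 2 * (n ^ 2 - 1 - i) = 2 * (n ^ 2 - 1) := by omega
  rw [e]
  ring

/-- **The right sum of (∗) at `z(P)`**: `Σᵢ Φₙ[i] (x z²)ⁱ z^{2(n²-i)} = z^{2n²} Φₙ(x)`.
[Silverman AEC IV.1, VII.2.2] [cite: SilvermanAEC2009, VII.2.2] -/
theorem padicEval_sum_Φ {x y : ℚ_[p]} (heq : W.toAffine.Equation x y) (hx : 1 < ‖x‖) (n : ℕ) :
    padicEval (∑ i ∈ Finset.range (n ^ 2 + 1),
      PowerSeries.C ((W.Φ n).coeff i) * W.formalXMulSq ^ i * PowerSeries.X ^ (2 * (n ^ 2 - i)))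
        (-x / y) = (-x / y) ^ (2 * n ^ 2) * (W.Φ n).eval x := by
  obtain ⟨-, -, hz1, -, -⟩ := W.param_facts heq hx
  rw [padicEval_finset_sum _ _ (fun i _ =>
    ((IsPadicInt.powerSeries_C (W.norm_coeff_Φ_le_one n i)).mul (W.isPadicInt_formalXMulSq.pow i)).mul
      (IsPadicInt.powerSeries_X.pow _)) hz1]
  have hdeg : (W.Φ n).natDegree < n ^ 2 + 1 := by
    refine (W.natDegree_Φ_le n).trans_lt ?_
    rw [Int.natAbs_natCast]
    exact Nat.lt_succ_self _
  rw [Polynomial.eval_eq_sum_range' hdeg, Finset.mul_sum]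
  refine Finset.sum_congr rfl fun i hi => ?_
  rw [Finset.mem_range] at hi
  rw [padicEval_C_mul_pow_mul_X_pow (W.norm_coeff_Φ_le_one n i) W.isPadicInt_formalXMulSq i _ hz1,
    W.padicEval_formalXMulSq_eq heq hx, mul_pow, ← pow_mul, mul_assoc, mul_assoc, ← pow_add]
  have e : 2 * i + 2 * (n ^ 2 - i) = 2 * n ^ 2 := by omega
  rw [e]
  ring

/-- **(∗) over `ℚ_p`**: for a `p`-integral Weierstrass equation over `ℚ_p`,
`(Σᵢ ΨSqₙ[i] uⁱ z^{2(n²-1-i)}) · z² · u([n](z)) = (Σᵢ Φₙ[i] uⁱ z^{2(n²-i)}) · [n](z)²` in `ℚ_p⟦z⟧`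
— both sides take the value `z(P)^{2n²} Φₙ(x(P)) z(nP)²` at `z(P)`, `P ∈ E₁(ℚ_p)`.
[Silverman AEC IV.1, VII.2.2, Exercise 3.7(d)] [cite: SilvermanAEC2009, VII.2.2] -/
theorem sum_ΨSq_mul_formalXMulSq_subst_formalMul_padic (n : ℕ) :
    (∑ i ∈ Finset.range (n ^ 2),
        PowerSeries.C ((W.ΨSq n).coeff i) * W.formalXMulSq ^ i * PowerSeries.X ^ (2 * (n ^ 2 - 1 - i))) *
      PowerSeries.X ^ 2 * W.formalXMulSq.subst (W.formalMul n) =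
    (∑ i ∈ Finset.range (n ^ 2 + 1),
        PowerSeries.C ((W.Φ n).coeff i) * W.formalXMulSq ^ i * PowerSeries.X ^ (2 * (n ^ 2 - i))) *
      W.formalMul n ^ 2 := by
  rcases Nat.eq_zero_or_pos n with rfl | hn
  · simp
  refine eq_of_padicEval_eq (((W.isPadicInt_sum_ΨSq n).mul (IsPadicInt.powerSeries_X.pow 2)).mul
    (W.isPadicInt_formalXMulSq_subst_formalMul n)) ((W.isPadicInt_sum_Φ n).mul
    ((W.isPadicInt_formalMul n).pow 2)) fun t ht => ?_
  obtain ⟨P, hP, rfl⟩ := W.exists_isInReductionKernel_formalParameter_eq_of_isIntegral ht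
  rcases P with _ | ⟨x, y, h⟩
  · rw [← Affine.Point.zero_def, formalParameter_zero, padicEval_zero_right, padicEval_zero_right,
      map_mul, map_mul, map_pow,
      PowerSeries.constantCoeff_X, zero_pow two_ne_zero, mul_zero, zero_mul, map_mul, map_pow,
      W.constantCoeff_formalMul, zero_pow two_ne_zero, mul_zero]
  have hx : 1 < ‖x‖ := (W.isInReductionKernel_some h).mp hP
  obtain ⟨hy0, hz0, hz1, -, -⟩ := W.param_facts h.left hx
  have hM := W.padicEval_formalMul_formalParameter n hP
  rw [W.formalParameter_some h] at hM ⊢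
  rw [padicEval_mul (((W.isPadicInt_sum_ΨSq n).mul (IsPadicInt.powerSeries_X.pow 2)))
      (W.isPadicInt_formalXMulSq_subst_formalMul n) hz1,
    padicEval_mul (W.isPadicInt_sum_ΨSq n) (IsPadicInt.powerSeries_X.pow 2) hz1,
    padicEval_pow IsPadicInt.powerSeries_X hz1, padicEval_X,
    padicEval_subst W.isPadicInt_formalXMulSq (W.isPadicInt_formalMul n) (W.constantCoeff_formalMul n) hz1,
    hM, W.padicEval_sum_ΨSq h.left hx n hn,
    padicEval_mul (W.isPadicInt_sum_Φ n) ((W.isPadicInt_formalMul n).pow 2) hz1,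
    padicEval_pow (W.isPadicInt_formalMul n) hz1, hM, W.padicEval_sum_Φ h.left hx n]
  -- case distinction on `nP`
  rcases hQ : n • (Affine.Point.some x y h : W.toAffine.Point) with _ | ⟨x', y', h'⟩
  · -- `nP = O`: `ΨSqₙ(x) = 0` and `z(nP) = 0`
    have hΨ : (W.ΨSq n).eval x = 0 := by
      rw [← W.zsmul_some_eq_zero_iff_eval_ΨSq h n, natCast_zsmul, hQ, ← Affine.Point.zero_def]
    rw [hΨ, ← Affine.Point.zero_def, formalParameter_zero, mul_zero, zero_mul, zero_mul,
      zero_pow two_ne_zero, mul_zero]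
  · -- `nP = (x', y') ∈ E₁(ℚ_p)`
    have hP' : W.IsInReductionKernel (Affine.Point.some x' y' h') := by
      rw [← hQ]; exact W.isInReductionKernel_nsmul hP n
    have hx' : 1 < ‖x'‖ := (W.isInReductionKernel_some h').mp hP'
    have hmul : x' * (W.ΨSq n).eval x = (W.Φ n).eval x :=
      W.mul_eval_ΨSq_of_zsmul_eq h n h' (by rw [natCast_zsmul, hQ])
    rw [W.formalParameter_some h', W.padicEval_formalXMulSq_eq h'.left hx', ← hmul]
    have e : 2 * n ^ 2 = 2 * (n ^ 2 - 1) + 2 := by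
      have : 1 ≤ n ^ 2 := Nat.one_le_pow _ _ hn
      omega
    rw [e, pow_add]
    ring

end Padic

/-! ### (∗) universally, and over every commutative ring -/

section Universal

/-- **(∗) for the universal Weierstrass equation over `ℤ[a₁, a₂, a₃, a₄, a₆]`.**  Each coefficient
of the difference of the two sides is a polynomial in the `aᵢ` vanishing at every point of `ℤ₂⁵`
(the specialisation is a `2`-integral equation over `ℚ₂`), hence zero (`MvPolynomial.funext`).
[Silverman AEC IV.1, IV.2.3, Exercise 3.7(d)] [cite: SilvermanAEC2009, VII.2.2] -/
theorem sum_ΨSq_mul_formalXMulSq_subst_formalMul_universalInt (n : ℕ) :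
    (∑ i ∈ Finset.range (n ^ 2),
        PowerSeries.C ((universalInt.ΨSq n).coeff i) * universalInt.formalXMulSq ^ i *
          PowerSeries.X ^ (2 * (n ^ 2 - 1 - i))) *
      PowerSeries.X ^ 2 * universalInt.formalXMulSq.subst (universalInt.formalMul n) =
    (∑ i ∈ Finset.range (n ^ 2 + 1),
        PowerSeries.C ((universalInt.Φ n).coeff i) * universalInt.formalXMulSq ^ i *
          PowerSeries.X ^ (2 * (n ^ 2 - i))) *
      universalInt.formalMul n ^ 2 := by
  haveI : Fact (Nat.Prime 2) := ⟨Nat.prime_two⟩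
  refine PowerSeries.ext fun k => ?_
  -- the coefficient identity, tested at every `a ∈ ℤ₂⁵`
  apply MvPolynomial.map_injective (Int.castRingHom ℤ_[2]) Int.cast_injective
  haveI : Infinite ℤ_[2] := Infinite.of_injective _ (Nat.cast_injective (R := ℤ_[2]))
  refine MvPolynomial.funext fun a => ?_
  rw [MvPolynomial.eval_map, MvPolynomial.eval_map]
  set ψ : MvPolynomial (Fin 5) ℤ →+* ℤ_[2] := MvPolynomial.eval₂Hom (Int.castRingHom ℤ_[2]) a with hψ
  change ψ _ = ψ _
  apply (show Function.Injective ((↑) : ℤ_[2] → ℚ_[2]) from Subtype.val_injective)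
  set φ : MvPolynomial (Fin 5) ℤ →+* ℚ_[2] := PadicInt.Coe.ringHom.comp ψ with hφ
  change φ (PowerSeries.coeff k _) = φ (PowerSeries.coeff k _)
  rw [← PowerSeries.coeff_map, ← PowerSeries.coeff_map]
  -- the specialised equation is `2`-integral
  haveI : (universalInt.map φ).IsIntegral ℤ_[2] :=
    ⟨⟨universalInt.map ψ, by rw [baseChange, map_map]; rfl⟩⟩
  congr 1
  rw [map_mul, map_mul, map_pow, PowerSeries.map_X, map_sum_ΨSq_formalXMulSq,
    map_formalXMulSq_subst_formalMul, map_mul, map_pow, map_sum_Φ_formalXMulSq, map_formalMul]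
  exact (universalInt.map φ).sum_ΨSq_mul_formalXMulSq_subst_formalMul_padic n

variable {R : Type*} [CommRing R] (W : WeierstrassCurve R)

/-- **`ΨSqₙ(x(z)) · x([n](z)) = Φₙ(x(z))` for every Weierstrass equation over every commutative
ring**, in the pole-free form
`(Σᵢ ΨSqₙ[i] uⁱ z^{2(n²-1-i)}) · z² · u([n](z)) = (Σᵢ Φₙ[i] uⁱ z^{2(n²-i)}) · [n](z)²`,
`u = z²x(z)`: the formal multiplication `[n]` of the formal group computes the `x`-coordinate of
`[n]` through the division polynomials. [Silverman AEC IV.2.3, Exercise 3.7(d), VII.2.2]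
[cite: SilvermanAEC2009, Exercise 3.7(d)] -/
theorem sum_ΨSq_mul_formalXMulSq_subst_formalMul (n : ℕ) :
    (∑ i ∈ Finset.range (n ^ 2),
        PowerSeries.C ((W.ΨSq n).coeff i) * W.formalXMulSq ^ i * PowerSeries.X ^ (2 * (n ^ 2 - 1 - i))) *
      PowerSeries.X ^ 2 * W.formalXMulSq.subst (W.formalMul n) =
    (∑ i ∈ Finset.range (n ^ 2 + 1),
        PowerSeries.C ((W.Φ n).coeff i) * W.formalXMulSq ^ i * PowerSeries.X ^ (2 * (n ^ 2 - i))) *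
      W.formalMul n ^ 2 := by
  have h := congrArg (PowerSeries.map W.universalEval)
    (sum_ΨSq_mul_formalXMulSq_subst_formalMul_universalInt n)
  rw [map_mul, map_mul, map_pow, PowerSeries.map_X, map_sum_ΨSq_formalXMulSq,
    map_formalXMulSq_subst_formalMul, map_mul, map_pow, map_sum_Φ_formalXMulSq, map_formalMul,
    universalInt_map] at h
  exact h

end Universal

/-! ### Characteristic `ℓ`: `deg ΨSq_ℓ = ℓ² - ℓ` for an ordinary curve -/

section OrderComparison

variable {R : Type*} [CommRing R]

/-- If `X^a F = X^b G` in `R⟦X⟧` with `F(0) ≠ 0`, `G(0) ≠ 0`, then `a = b` and `F(0) = G(0)`.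
[folklore] -/
theorem _root_.Literature.NumberTheory.EllipticCurves.eq_and_constantCoeff_eq_of_X_pow_mul_eq
    {a b : ℕ} {F G : R⟦X⟧} (h : PowerSeries.X ^ a * F = PowerSeries.X ^ b * G)
    (hF : PowerSeries.constantCoeff F ≠ 0) (hG : PowerSeries.constantCoeff G ≠ 0) :
    a = b ∧ PowerSeries.constantCoeff F = PowerSeries.constantCoeff G := by
  have ha := congrArg (PowerSeries.coeff a) h
  have hb := congrArg (PowerSeries.coeff b) h
  simp only [PowerSeries.coeff_X_pow_mul', le_refl, if_true, Nat.sub_self,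
    PowerSeries.coeff_zero_eq_constantCoeff_apply] at ha hb
  rcases lt_trichotomy a b with hab | rfl | hab
  · rw [if_neg (not_le.mpr hab)] at ha
    exact absurd ha hF
  · rw [if_pos le_rfl, Nat.sub_self, PowerSeries.coeff_zero_eq_constantCoeff_apply] at ha
    exact ⟨rfl, ha⟩
  · rw [if_neg (not_le.mpr hab)] at hb
    exact absurd hb.symm hG

end OrderComparison

section CharP

variable {S : Type*} [CommRing S] (ℓ : ℕ) [Fact ℓ.Prime] [CharP S ℓ] (V : WeierstrassCurve S)

/-- **`[ℓ](z) = z^ℓ · (A_ℓ + O(z))` in characteristic `ℓ`** (`ℓ` odd): the coefficients of `zᵏ`,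
`ℓ ∤ k`, of `[ℓ]` vanish and the coefficient of `z^ℓ` is the Hasse invariant (Katz–Mazur 12.4.2:
`[ℓ] = V(z^ℓ)`, `V'(0) =` Hasse invariant). [Katz–Mazur 1985, 12.4.2; Silverman AEC IV.4.4]
[cite: SilvermanAEC2009, IV.4.4] -/
theorem exists_formalMul_prime_eq_X_pow_mul (hℓ2 : ℓ ≠ 2) :
    ∃ h : S⟦X⟧, V.formalMul ℓ = PowerSeries.X ^ ℓ * h ∧
      PowerSeries.constantCoeff h = V.hasseCoeff ℓ := by
  have hℓ : ℓ.Prime := Fact.out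
  have hdvd : PowerSeries.X ^ ℓ ∣ V.formalMul ℓ := by
    rw [PowerSeries.X_pow_dvd_iff]
    intro m hm
    rcases Nat.eq_zero_or_pos m with rfl | hm0
    · rw [PowerSeries.coeff_zero_eq_constantCoeff_apply, constantCoeff_formalMul]
    · have hnd : ¬ ℓ ∣ m := fun hd => absurd (Nat.le_of_dvd hm0 hd) (not_le.mpr hm)
      have hmem := coeff_formalMul_prime_mem_span (p := ℓ) (W := V) hnd
      rwa [CharP.cast_eq_zero, Ideal.mem_span_singleton, zero_dvd_iff] at hmem
  obtain ⟨h, hh⟩ := hdvd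
  refine ⟨h, hh, ?_⟩
  have hc := V.coeff_prime_formalMul_sub_hasseCoeff_mem_span ℓ hℓ2
  rw [CharP.cast_eq_zero, Ideal.mem_span_singleton, zero_dvd_iff, sub_eq_zero, hh,
    PowerSeries.coeff_X_pow_mul', if_pos le_rfl, Nat.sub_self,
    PowerSeries.coeff_zero_eq_constantCoeff_apply] at hc
  exact hc

variable [IsDomain S]

/-- **`deg ΨSq_ℓ = ℓ² - ℓ` and `lead ΨSq_ℓ = A_ℓ²` for an ordinary curve in characteristic `ℓ`.**
Over an integral domain of odd prime characteristic `ℓ`, if the Hasse invariant `A_ℓ(W)`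
(`hasseCoeff`) is nonzero then the univariate `ℓ`-division polynomial `ΨSq_ℓ = ψ_ℓ²` has degree
exactly `ℓ² - ℓ` and leading coefficient `A_ℓ²`.  (Compare orders of vanishing at `z = 0` in (∗):
the right side is `z^{2ℓ}(A_ℓ² + O(z))`, the left side `z^{2(ℓ²-D)}(c + O(z))`.)  This is the
division-polynomial form of `#Ẽ[ℓ] = ℓ` for an ordinary curve (Silverman AEC V.3.1(a)).
[Silverman AEC V.3.1(a), Exercise 3.7; Serre 1968, IV, A.2.2] [cite: SilvermanAEC2009, V.3.1] -/
theorem natDegree_ΨSq_eq_of_hasseCoeff_ne_zero (hℓ2 : ℓ ≠ 2) (hA : V.hasseCoeff ℓ ≠ 0) :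
    (V.ΨSq ℓ).natDegree = ℓ ^ 2 - ℓ ∧ (V.ΨSq ℓ).leadingCoeff = V.hasseCoeff ℓ ^ 2 := by
  have hℓ : ℓ.Prime := Fact.out
  have hℓ1 : 1 ≤ ℓ ^ 2 := Nat.one_le_pow _ _ hℓ.pos
  have key := V.sum_ΨSq_mul_formalXMulSq_subst_formalMul ℓ
  obtain ⟨h, hh, hh0⟩ := V.exists_formalMul_prime_eq_X_pow_mul ℓ hℓ2
  set D := (V.ΨSq ℓ).natDegree with hD
  set c := (V.ΨSq ℓ).leadingCoeff with hc
  have hDle : D ≤ ℓ ^ 2 - 1 := by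
    have := V.natDegree_ΨSq_le ℓ
    rwa [Int.natAbs_natCast] at this
  -- constant coefficients of the two cofactors
  have hu1 : PowerSeries.constantCoeff (V.formalXMulSq.subst (V.formalMul ℓ)) = 1 := by
    rw [constantCoeff_subst_eq_constantCoeff (V.constantCoeff_formalMul ℓ), constantCoeff_formalXMulSq]
  have hΦ1 : PowerSeries.constantCoeff (∑ i ∈ Finset.range (ℓ ^ 2 + 1),
      PowerSeries.C ((V.Φ ℓ).coeff i) * V.formalXMulSq ^ i * PowerSeries.X ^ (2 * (ℓ ^ 2 - i))) = 1 := by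
    rw [map_sum, Finset.sum_eq_single (ℓ ^ 2)]
    · rw [map_mul, map_mul, map_pow, map_pow, PowerSeries.constantCoeff_C, constantCoeff_formalXMulSq,
        one_pow, mul_one, Nat.sub_self, mul_zero, pow_zero, mul_one]
      have := V.coeff_Φ ℓ
      rwa [Int.natAbs_natCast] at this
    · intro i hi hne
      rw [Finset.mem_range] at hi
      have hpos : 2 * (ℓ ^ 2 - i) ≠ 0 := by omega
      rw [map_mul, map_pow, PowerSeries.constantCoeff_X, zero_pow hpos, mul_zero]
    · intro hnot
      exact absurd (Finset.mem_range.mpr (Nat.lt_succ_self _)) hnot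
  -- the right side is `X^{2ℓ} · (Φ-sum · h²)`
  have hR : (∑ i ∈ Finset.range (ℓ ^ 2 + 1),
      PowerSeries.C ((V.Φ ℓ).coeff i) * V.formalXMulSq ^ i * PowerSeries.X ^ (2 * (ℓ ^ 2 - i))) *
        V.formalMul ℓ ^ 2 = PowerSeries.X ^ (2 * ℓ) * ((∑ i ∈ Finset.range (ℓ ^ 2 + 1),
      PowerSeries.C ((V.Φ ℓ).coeff i) * V.formalXMulSq ^ i * PowerSeries.X ^ (2 * (ℓ ^ 2 - i))) * h ^ 2) := by
    rw [hh]; ring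
  have hR0 : PowerSeries.constantCoeff ((∑ i ∈ Finset.range (ℓ ^ 2 + 1),
      PowerSeries.C ((V.Φ ℓ).coeff i) * V.formalXMulSq ^ i * PowerSeries.X ^ (2 * (ℓ ^ 2 - i))) * h ^ 2) =
        V.hasseCoeff ℓ ^ 2 := by
    rw [map_mul, map_pow, hΦ1, hh0, one_mul]
  have hA2 : V.hasseCoeff ℓ ^ 2 ≠ 0 := pow_ne_zero 2 hA
  -- `ΨSq_ℓ ≠ 0`
  have hΨ0 : V.ΨSq ℓ ≠ 0 := by
    intro h0
    have hL : (∑ i ∈ Finset.range (ℓ ^ 2),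
        PowerSeries.C ((V.ΨSq ℓ).coeff i) * V.formalXMulSq ^ i * PowerSeries.X ^ (2 * (ℓ ^ 2 - 1 - i))) = 0 :=
      Finset.sum_eq_zero fun i _ => by rw [h0, Polynomial.coeff_zero, map_zero, zero_mul, zero_mul]
    rw [hL, zero_mul, zero_mul, hR] at key
    have := congrArg (PowerSeries.coeff (2 * ℓ)) key
    rw [map_zero, PowerSeries.coeff_X_pow_mul', if_pos le_rfl, Nat.sub_self,
      PowerSeries.coeff_zero_eq_constantCoeff_apply, hR0] at this
    exact hA2 this.symm
  have hc0 : c ≠ 0 := leadingCoeff_ne_zero.mpr hΨ0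
  -- the left sum is `X^{2(ℓ²-1-D)} · B` with `B(0) = c`
  have hL : (∑ i ∈ Finset.range (ℓ ^ 2),
      PowerSeries.C ((V.ΨSq ℓ).coeff i) * V.formalXMulSq ^ i * PowerSeries.X ^ (2 * (ℓ ^ 2 - 1 - i))) =
        PowerSeries.X ^ (2 * (ℓ ^ 2 - 1 - D)) * ∑ i ∈ Finset.range (D + 1),
      PowerSeries.C ((V.ΨSq ℓ).coeff i) * V.formalXMulSq ^ i * PowerSeries.X ^ (2 * (D - i)) := by
    rw [Finset.mul_sum, ← Finset.sum_subset (Finset.range_subset_range.mpr (by omega : D + 1 ≤ ℓ ^ 2))]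
    · refine Finset.sum_congr rfl fun i hi => ?_
      rw [Finset.mem_range] at hi
      have e : 2 * (ℓ ^ 2 - 1 - i) = 2 * (ℓ ^ 2 - 1 - D) + 2 * (D - i) := by omega
      rw [e, pow_add]; ring
    · intro i hi hnot
      rw [Finset.mem_range, not_lt] at hnot
      rw [Polynomial.coeff_eq_zero_of_natDegree_lt (by omega), map_zero, zero_mul, zero_mul]
  have hB0 : PowerSeries.constantCoeff (∑ i ∈ Finset.range (D + 1),
      PowerSeries.C ((V.ΨSq ℓ).coeff i) * V.formalXMulSq ^ i * PowerSeries.X ^ (2 * (D - i))) = c := by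
    rw [map_sum, Finset.sum_eq_single D]
    · rw [map_mul, map_mul, map_pow, map_pow, PowerSeries.constantCoeff_C, constantCoeff_formalXMulSq,
        one_pow, mul_one, Nat.sub_self, mul_zero, pow_zero, mul_one]
      rfl
    · intro i hi hne
      rw [Finset.mem_range] at hi
      have hpos : 2 * (D - i) ≠ 0 := by omega
      rw [map_mul, map_pow, PowerSeries.constantCoeff_X, zero_pow hpos, mul_zero]
    · intro hnot
      exact absurd (Finset.mem_range.mpr (Nat.lt_succ_self _)) hnot
  -- compare
  rw [hL, hR, mul_assoc, mul_assoc, ← mul_assoc _ (PowerSeries.X ^ 2), mul_comm _ (PowerSeries.X ^ 2),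
    ← mul_assoc, ← mul_assoc, ← pow_add, mul_assoc] at key
  have hF0 : PowerSeries.constantCoeff ((∑ i ∈ Finset.range (D + 1),
      PowerSeries.C ((V.ΨSq ℓ).coeff i) * V.formalXMulSq ^ i * PowerSeries.X ^ (2 * (D - i))) *
        V.formalXMulSq.subst (V.formalMul ℓ)) ≠ 0 := by
    rw [map_mul, hB0, hu1, mul_one]; exact hc0
  obtain ⟨he, hce⟩ := eq_and_constantCoeff_eq_of_X_pow_mul_eq key hF0 (by rw [hR0]; exact hA2)
  rw [map_mul, hB0, hu1, mul_one, hR0] at hce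
  exact ⟨by omega, hce⟩

/-- `deg ΨSq_ℓ = ℓ² - ℓ` for an ordinary curve in odd characteristic `ℓ`.
[cite: SilvermanAEC2009, V.3.1] -/
theorem natDegree_ΨSq_prime_eq (hℓ2 : ℓ ≠ 2) (hA : V.hasseCoeff ℓ ≠ 0) :
    (V.ΨSq ℓ).natDegree = ℓ ^ 2 - ℓ :=
  (V.natDegree_ΨSq_eq_of_hasseCoeff_ne_zero ℓ hℓ2 hA).1

/-- `lead ΨSq_ℓ = A_ℓ²` for an ordinary curve in odd characteristic `ℓ`; in particular
`ΨSq_ℓ ≠ 0`. [cite: SilvermanAEC2009, V.3.1] -/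
theorem leadingCoeff_ΨSq_prime_eq (hℓ2 : ℓ ≠ 2) (hA : V.hasseCoeff ℓ ≠ 0) :
    (V.ΨSq ℓ).leadingCoeff = V.hasseCoeff ℓ ^ 2 :=
  (V.natDegree_ΨSq_eq_of_hasseCoeff_ne_zero ℓ hℓ2 hA).2

/-- `ΨSq_ℓ ≠ 0` for an ordinary curve in odd characteristic `ℓ`. [cite: SilvermanAEC2009, V.3.1] -/
theorem ΨSq_prime_ne_zero_of_hasseCoeff_ne_zero (hℓ2 : ℓ ≠ 2) (hA : V.hasseCoeff ℓ ≠ 0) :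
    V.ΨSq ℓ ≠ 0 := by
  intro h0
  have := V.leadingCoeff_ΨSq_prime_eq ℓ hℓ2 hA
  rw [h0, Polynomial.leadingCoeff_zero] at this
  exact pow_ne_zero 2 hA this.symm

end CharP

end WeierstrassCurve

end
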